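import Mathlib
import Summits.Ventures.PercRepro2.Defs
import Summits.Ventures.PercRepro2.Independence
import Summits.Ventures.PercRepro2.Harris
import Summits.Ventures.PercRepro2.Graph
import Summits.Ventures.PercRepro2.Exploration
import Summits.Ventures.PercRepro2.Events
import Summits.Ventures.PercRepro2.FourFunctions
import Summits.Ventures.PercRepro2.Induced
import Summits.Ventures.PercRepro2.Frontier
import Summits.Ventures.PercRepro2.ObsIndependence
import Summits.Ventures.PercRepro2.BHK
import Summits.Ventures.PercRepro2.BHKEvents
import Summits.Ventures.PercRepro2.OrderPreservation
import Summits.Ventures.PercRepro2.BHKAvoid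
import Summits.Ventures.PercRepro2.SameClusterAvoid
import Summits.Ventures.PercRepro2.CaseOneRegime
import Summits.Ventures.PercRepro2.CaseOnePos
import Summits.Ventures.PercRepro2.CaseOneJ11
import Summits.Ventures.PercRepro2.CaseOneRV
import Summits.Ventures.PercRepro2.CaseOnePendant
import Summits.Ventures.PercRepro2.CaseOnePendantAny
import Summits.Ventures.PercRepro2.CaseOnePendantNec
import Summits.Ventures.PercRepro2.HullDefs
import Summits.Ventures.PercRepro2.OneEdge
import Summits.Ventures.PercRepro2.HCov
import Summits.Ventures.PercRepro2.HCovSwap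
import Summits.Ventures.PercRepro2.OddsLemma
import Summits.Ventures.PercRepro2.RV
import Summits.Ventures.PercRepro2.RVBridge
import Summits.Ventures.PercRepro2.CaseOneDWorld
import Summits.Ventures.PercRepro2.CaseOneDWorldPin
import Summits.Ventures.PercRepro2.CaseOneDWorldEdge
import Summits.Ventures.PercRepro2.CaseOnePendantAnyI
import Summits.Ventures.PercRepro2.CaseOneDWorldI
import Summits.Ventures.PercRepro2.CaseOneRootsOnly

/-!
# `(i)` and `(J1₁)` when every edge at `a₃` goes to a root (blind cell PercRepro2, p1 g14; S5 §2.1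
(K7′) completed in the kernel)

The `(i)` mirror of `CaseOneRootsOnly.lean`. In the D-world, for a root-only `a₃`, the event
`{b ∈ C₁}` also ignores an `a₁a₃`-edge (`conn_a1_b_update_true_iff_of_root`: a path from `b` into `a₃`
uses an open root edge at `a₃`, which on `D` is an `a₁`-edge, so `b ∈ C₁` already), and the pinning
identity has the shape of (E) with a BHK 1.4 bracket for the cluster of `a₂` avoiding `{a₁, a₃}`
(`iExprD_a1_edge_of_root`, `covDwI_nonneg`); an `a₂a₃`-edge scales everything (`iExprD_a2_edge`).
Induction on the non-null edges at `a₃` with the null base (`iExprD_eq_zero_of_null`) gives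
**`zSplitID_of_rootsOnly`**, **`zSplitI_of_rootsOnly`** and, with `zSplitII_of_rootsOnly`,
**`jOneOne_of_rootsOnly`**: `(J1₁)` for every `a₃` all of whose edges join the roots, any
multiplicities, any weights (K7 is one `a₁`-edge; mine-c's `cd_of_two_root` one `a₁`- and one
`a₂`-edge). Own code; standard axioms.
-/

namespace Summit.Ventures.PercRepro2

namespace CaseOne

/-! ## The pointwise fact -/

section Pointwise
variable {V : Type*} {E : Type*} [DecidableEq E] {ends : E → Sym2 V} {a₁ a₂ a₃ : V}

omit [DecidableEq E] in
/-- On `D`, if every edge at `a₃` is a root edge, a vertex `x ≠ a₃` joined to `a₃` is joined to `a₁`. -/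
lemma conn_a1_of_conn_a3_of_root
    (hroot : ∀ e, a₃ ∈ ends e → ends e = s(a₁, a₃) ∨ ends e = s(a₂, a₃)) {ω : Config E}
    (hD : ω ∈ Dw ends a₁ a₂ a₃) {x : V} (hx : x ≠ a₃) (h : Conn ends ω x a₃) : Conn ends ω x a₁ := by
  let S : Set V := {y | Conn ends ω x y ∧ (y = a₃ → Conn ends ω x a₁)}
  have hS : ∀ y ∈ S, ∀ z, (openGraph ends ω).Adj y z → z ∈ S := by
    intro y hy z hyz
    obtain ⟨_, e, he, hends⟩ := openGraph_adj.1 hyz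
    refine ⟨conn_trans hy.1 (conn_of_openAdj ⟨e, he, hends⟩), fun hz => ?_⟩
    have h3 : a₃ ∈ ends e := by rw [hends, hz]; exact Sym2.mem_mk_right _ _
    rcases hroot e h3 with h1 | h2
    · rw [hz, h1, Sym2.eq_iff] at hends
      rcases hends with ⟨hy1, _⟩ | ⟨hy3, h31⟩
      · rw [hy1]; exact hy.1
      · rw [hy3, h31]; exact hy.1
    · have hc : ω e = false := update_false_of_mem_Dw (a₁ := a₁) h2 hD
      rw [hc] at he
      exact Bool.noConfusion he
  have hx' : x ∈ S := ⟨conn_refl ends ω x, fun h => absurd h hx⟩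
  exact (mem_of_conn_of_closed hS hx' h).2 rfl

variable {e₁ : E}

/-- On `D`, for a root-only `a₃`, `{b ∈ C₁}` ignores an `a₁a₃`-edge (`b ≠ a₃`). -/
lemma conn_a1_b_update_true_iff_of_root
    (hroot : ∀ e, a₃ ∈ ends e → ends e = s(a₁, a₃) ∨ ends e = s(a₂, a₃))
    (he : ends e₁ = s(a₁, a₃)) {ω₀ : Config E} (hD : ω₀ ∈ Dw ends a₁ a₂ a₃) {b : V} (hb : b ≠ a₃) :
    Conn ends (Function.update ω₀ e₁ true) a₁ b ↔ Conn ends ω₀ a₁ b := by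
  rw [OneEdge.conn_update_true_iff he ω₀ a₁ b]
  constructor
  · rintro (h | ⟨_, h⟩ | ⟨_, h⟩)
    · exact h
    · exact conn_symm (conn_a1_of_conn_a3_of_root hroot hD hb (conn_symm h))
    · exact h
  · exact fun h => Or.inl h

/-- The event `{b ∈ C₁}` qualifies for the pinning lemmas under the root-only hypothesis. -/
lemma b1_event_update_of_root
    (hroot : ∀ e, a₃ ∈ ends e → ends e = s(a₁, a₃) ∨ ends e = s(a₂, a₃))
    (he : ends e₁ = s(a₁, a₃)) {b : V} (hb : b ≠ a₃) :
    ∀ ω₀ ∈ Dw ends a₁ a₂ a₃, Function.update ω₀ e₁ true ∈ connEvent ends a₁ b ↔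
      ω₀ ∈ connEvent ends a₁ b :=
  fun ω₀ hD => by
    simp only [mem_connEvent]
    exact conn_a1_b_update_true_iff_of_root hroot he hD hb

end Pointwise

/-! ## Identity (E) for `(i)` on the root-only class -/

section IdentityE
variable {V : Type*} {E : Type*} [Fintype E] [DecidableEq E] {R : Type*} [CommRing R]
variable {ends : E → Sym2 V} {a₁ a₂ a₃ : V} {e₁ : E}

/-- `iExprD` is homogeneous in the threshold pair. -/
lemma iExprD_smul (p : E → R) (ends : E → Sym2 V) (o a₁ a₂ a₃ b : V) (t c₀ c₁ : R) :
    iExprD p ends o a₁ a₂ a₃ b (t * c₀) (t * c₁) = t * iExprD p ends o a₁ a₂ a₃ b c₀ c₁ := by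
  rw [iExprD_eq, iExprD_eq]
  ring

/-- **Identity (E) for `(i)`**, root-only `a₃`: pinning an `a₁a₃`-edge,
`iExprD p c₀ c₁ = −p₁ · c₁ · [P₀(D) P₀(D, b ∈ C₁, o ∈ C₂) − P₀(D, b ∈ C₁) P₀(D, o ∈ C₂)] + (1 − p₁) · iExprD p₀ c₀ c₁`. -/
theorem iExprD_a1_edge_of_root (p : E → R)
    (hroot : ∀ e, a₃ ∈ ends e → ends e = s(a₁, a₃) ∨ ends e = s(a₂, a₃))
    (he : ends e₁ = s(a₁, a₃)) {o b : V} (hb : b ≠ a₃) (c₀ c₁ : R) :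
    iExprD p ends o a₁ a₂ a₃ b c₀ c₁ =
      -(p e₁ * c₁ * (prob (Function.update p e₁ 0) (Dw ends a₁ a₂ a₃) *
          prob (Function.update p e₁ 0) (connEvent ends a₁ b ∩ connEvent ends a₂ o ∩
            Dw ends a₁ a₂ a₃) -
        prob (Function.update p e₁ 0) (connEvent ends a₁ b ∩ Dw ends a₁ a₂ a₃) *
          prob (Function.update p e₁ 0) (connEvent ends a₂ o ∩ Dw ends a₁ a₂ a₃))) +
      (1 - p e₁) * iExprD (Function.update p e₁ 0) ends o a₁ a₂ a₃ b c₀ c₁ := by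
  rw [iExprD_eq, iExprD_eq]
  rw [← B₁AO_inter_Dw, ← AO_inter_Dw, ← B₁A_inter_Dw, ← A_inter_Dw]
  have hB := b1_event_update_of_root hroot he hb
  have hO := a2_event_update (a₂ := a₂) he o
  have hBO := inter_event_update hB hO
  have hU := univ_event_update (ends := ends) (a₁ := a₁) (a₂ := a₂) (a₃ := a₃) (e₁ := e₁)
  have hd : prob p (Dw ends a₁ a₂ a₃) = prob (Function.update p e₁ 0) (Dw ends a₁ a₂ a₃) := by
    have := prob_inter_Dw_update p he Set.univ hU 0
    rw [Set.univ_inter] at this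
    exact this.symm
  have hdB : prob p (connEvent ends a₁ b ∩ Dw ends a₁ a₂ a₃) =
      prob (Function.update p e₁ 0) (connEvent ends a₁ b ∩ Dw ends a₁ a₂ a₃) :=
    (prob_inter_Dw_update p he _ hB 0).symm
  have e1 : connEvent ends a₁ b ∩ connEvent ends a₁ a₃ ∩ connEvent ends a₂ o ∩ Dw ends a₁ a₂ a₃ =
      (connEvent ends a₁ b ∩ connEvent ends a₂ o) ∩ connEvent ends a₁ a₃ ∩ Dw ends a₁ a₂ a₃ := by
    ext ω; simp only [Set.mem_inter_iff]; tauto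
  have e2 : connEvent ends a₁ a₃ ∩ connEvent ends a₂ o ∩ Dw ends a₁ a₂ a₃ =
      connEvent ends a₂ o ∩ connEvent ends a₁ a₃ ∩ Dw ends a₁ a₂ a₃ := by
    ext ω; simp only [Set.mem_inter_iff]; tauto
  have hBAO := prob_A_inter_Dw_pin p he _ hBO
  have hAO := prob_A_inter_Dw_pin p he _ hO
  have hBA := prob_A_inter_Dw_pin p he _ hB
  have hA := prob_A_inter_Dw_pin p he _ hU
  rw [Set.univ_inter, Set.univ_inter] at hA
  rw [e1, e2, hBAO, hAO, hBA, hA, hd, hdB]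
  ring

/-- `iExprD` with an `a₂a₃`-edge pinned: `iExprD p = (1 − p₂)² · iExprD p₀`. -/
theorem iExprD_a2_edge (p : E → R) {e₂ : E} (he : ends e₂ = s(a₂, a₃)) (o b : V) (c₀ c₁ : R) :
    iExprD p ends o a₁ a₂ a₃ b c₀ c₁ =
      (1 - p e₂) ^ 2 * iExprD (Function.update p e₂ 0) ends o a₁ a₂ a₃ b c₀ c₁ := by
  rw [iExprD_eq, iExprD_eq]
  rw [← B₁AO_inter_Dw, ← AO_inter_Dw, ← B₁A_inter_Dw, ← A_inter_Dw]
  rw [prob_a2_edge_of_subset_Dw p he (Y := Dw ends a₁ a₂ a₃) (fun _ h => h),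
    prob_a2_edge_of_subset_Dw p he (Y := connEvent ends a₁ b ∩ Dw ends a₁ a₂ a₃) (fun _ h => h.2),
    prob_a2_edge_of_subset_Dw p he (Y := connEvent ends a₁ b ∩ connEvent ends a₁ a₃ ∩
      connEvent ends a₂ o ∩ Dw ends a₁ a₂ a₃) (fun _ h => h.2),
    prob_a2_edge_of_subset_Dw p he (Y := connEvent ends a₁ a₃ ∩ connEvent ends a₂ o ∩
      Dw ends a₁ a₂ a₃) (fun _ h => h.2),
    prob_a2_edge_of_subset_Dw p he (Y := connEvent ends a₁ b ∩ connEvent ends a₁ a₃ ∩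
      Dw ends a₁ a₂ a₃) (fun _ h => h.2),
    prob_a2_edge_of_subset_Dw p he (Y := connEvent ends a₁ a₃ ∩ Dw ends a₁ a₂ a₃) (fun _ h => h.2)]
  ring

/-- **`iExprD = 0` when every edge at `a₃` is null.** -/
theorem iExprD_eq_zero_of_null (p : E → R) (hnull : ∀ e, a₃ ∈ ends e → p e = 0) {o b : V}
    (h1 : a₁ ≠ a₃) (c₀ c₁ : R) : iExprD p ends o a₁ a₂ a₃ b c₀ c₁ = 0 := by
  rw [iExprD_eq]
  have e1 : connEvent ends a₁ b ∩ connEvent ends a₁ a₃ ∩ connEvent ends a₂ o ∩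
      (connEvent ends a₁ a₂)ᶜ = connEvent ends a₁ b ∩ connEvent ends a₁ a₃ ∩
      (connEvent ends a₂ o ∩ (connEvent ends a₁ a₂)ᶜ) := by rw [Set.inter_assoc]
  have e2 : connEvent ends a₁ a₃ ∩ connEvent ends a₂ o ∩ (connEvent ends a₁ a₂)ᶜ =
      Set.univ ∩ connEvent ends a₁ a₃ ∩ (connEvent ends a₂ o ∩ (connEvent ends a₁ a₂)ᶜ) := by
    rw [Set.univ_inter, Set.inter_assoc]
  have e4 : connEvent ends a₁ a₃ ∩ (connEvent ends a₁ a₂)ᶜ =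
      Set.univ ∩ connEvent ends a₁ a₃ ∩ (connEvent ends a₁ a₂)ᶜ := by rw [Set.univ_inter]
  rw [e1, e2, e4, prob_A_eq_zero_of_null p hnull h1, prob_A_eq_zero_of_null p hnull h1,
    prob_A_eq_zero_of_null p hnull h1, prob_A_eq_zero_of_null p hnull h1]
  ring

end IdentityE

section Order
variable {V : Type*} {E : Type*} [Fintype E] [DecidableEq E] [Fintype V] [DecidableEq V]
  {R : Type*} [Field R] [LinearOrder R] [IsStrictOrderedRing R]
variable {ends : E → Sym2 V} {a₁ a₂ a₃ : V}

/-- **BHK 1.4 in the D-world**: `P(D, b ∈ C₁, o ∈ C₂) P(D) ≤ P(D, b ∈ C₁) P(D, o ∈ C₂)` (the cluster of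
`a₂` avoiding `{a₁, a₃}`, against the cluster of `a₁`). -/
theorem covDwI_nonpos (p : E → R) (hp : IsProbVec p) (ends : E → Sym2 V) (o a₁ a₂ a₃ b : V) :
    prob p (Dw ends a₁ a₂ a₃) *
        prob p (connEvent ends a₁ b ∩ connEvent ends a₂ o ∩ Dw ends a₁ a₂ a₃) -
      prob p (connEvent ends a₁ b ∩ Dw ends a₁ a₂ a₃) *
        prob p (connEvent ends a₂ o ∩ Dw ends a₁ a₂ a₃) ≤ 0 := by
  have h := bhk_cross_cluster_avoid p hp ends a₂ a₁ (X := ({a₁, a₃} : Finset V)) (by simp)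
    (isUpperSet_mem_setOf o) (isUpperSet_mem_setOf b)
  rw [← connEvent_eq_clusterInEvent ends a₂ o, ← connEvent_eq_clusterInEvent ends a₁ b,
    ← Dw_eq_avoidAll] at h
  have e1 : connEvent ends a₂ o ∩ connEvent ends a₁ b ∩ Dw ends a₁ a₂ a₃ =
      connEvent ends a₁ b ∩ connEvent ends a₂ o ∩ Dw ends a₁ a₂ a₃ := by
    ext ω; simp only [Set.mem_inter_iff]; tauto
  rw [e1] at h
  linarith [h]

/-- **`ZSplitID` lifts along an `a₁a₃`-edge** for a root-only `a₃`. -/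
theorem zSplitID_of_a1_edge_of_root (p : E → R) (hp : IsProbVec p) {e₁ : E}
    (hroot : ∀ e, a₃ ∈ ends e → ends e = s(a₁, a₃) ∨ ends e = s(a₂, a₃))
    (he : ends e₁ = s(a₁, a₃)) {o b : V} (hb : b ≠ a₃)
    (h : ZSplitID (Function.update p e₁ 0) ends o a₁ a₂ a₃ b) : ZSplitID p ends o a₁ a₂ a₃ b := by
  unfold ZSplitID at h ⊢
  rw [iExprD_a1_edge_of_root p hroot he hb, Dpd_a1_edge p he, Dpdo_a1_edge p he o, iExprD_smul]
  have hp0 : IsProbVec (Function.update p e₁ 0) := hp.update e₁ le_rfl zero_le_one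
  have hcov := covDwI_nonpos (Function.update p e₁ 0) hp0 ends o a₁ a₂ a₃ b
  have h1 : 0 ≤ p e₁ := hp.nonneg e₁
  have h2 : 0 ≤ 1 - p e₁ := by linarith [hp.le_one e₁]
  have hD : 0 ≤ Dpd (Function.update p e₁ 0) ends a₁ a₂ a₃ := prob_nonneg hp0 _
  have t1 := mul_nonpos_of_nonneg_of_nonpos (mul_nonneg h1 (mul_nonneg h2 hD)) hcov
  have t2 := mul_nonneg h2 (mul_nonneg h2 h)
  linarith [t1, t2]

omit [Fintype V] [DecidableEq V] in
/-- **`ZSplitID` lifts along an `a₂a₃`-edge.** -/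
theorem zSplitID_of_a2_edge (p : E → R) (hp : IsProbVec p) {e₂ : E} (he : ends e₂ = s(a₂, a₃))
    (o b : V) (h : ZSplitID (Function.update p e₂ 0) ends o a₁ a₂ a₃ b) :
    ZSplitID p ends o a₁ a₂ a₃ b := by
  unfold ZSplitID at h ⊢
  rw [iExprD_a2_edge p he o b, Dpd_a2_edge p he, Dpdo_a2_edge p he o, iExprD_smul]
  have h2 : 0 ≤ 1 - p e₂ := by linarith [hp.le_one e₂]
  exact mul_nonneg (pow_nonneg h2 2) (mul_nonneg h2 h)

/-- **`ZSplitID` for the root-only class.** -/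
theorem zSplitID_of_rootsOnly (p : E → R) (hp : IsProbVec p)
    (hroot : ∀ e, a₃ ∈ ends e → ends e = s(a₁, a₃) ∨ ends e = s(a₂, a₃)) (h1 : a₁ ≠ a₃)
    {o b : V} (hb : b ≠ a₃) : ZSplitID p ends o a₁ a₂ a₃ b := by
  generalize hn : (liveAt p ends a₃).card = n
  induction n using Nat.strong_induction_on generalizing p with
  | _ n ih =>
    by_cases h0 : liveAt p ends a₃ = ∅
    · have hnull : ∀ e, a₃ ∈ ends e → p e = 0 := by
        intro e he
        by_contra hc
        have : e ∈ liveAt p ends a₃ := by simp [liveAt, he, hc]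
        rw [h0] at this
        exact absurd this (Finset.notMem_empty e)
      unfold ZSplitID
      rw [iExprD_eq_zero_of_null p hnull h1]
    · obtain ⟨e, he⟩ := Finset.nonempty_iff_ne_empty.mpr h0
      have he' : a₃ ∈ ends e := by
        have := he
        simp only [liveAt, Finset.mem_filter, Finset.mem_univ, true_and] at this
        exact this.1
      have hlt : ((liveAt p ends a₃).erase e).card < n := by
        rw [← hn]; exact Finset.card_erase_lt_of_mem he
      have hp0 : IsProbVec (Function.update p e 0) := hp.update e le_rfl zero_le_one
      have hrec := ih _ hlt (Function.update p e 0) hp0 (by rw [liveAt_update])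
      rcases hroot e he' with h | h
      · exact zSplitID_of_a1_edge_of_root p hp hroot h hb hrec
      · exact zSplitID_of_a2_edge p hp h o b hrec

/-- **`(i)` for the root-only class.** -/
theorem zSplitI_of_rootsOnly (p : E → R) (hp : IsProbVec p)
    (hroot : ∀ e, a₃ ∈ ends e → ends e = s(a₁, a₃) ∨ ends e = s(a₂, a₃)) (h1 : a₁ ≠ a₃)
    (o : V) {b : V} (hb : b ≠ a₃) : ZSplitI p ends o a₁ a₂ a₃ b :=
  zSplitI_of_dworld p hp ends o a₁ a₂ a₃ b (zSplitID_of_rootsOnly p hp hroot h1 hb)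

/-- **`(J1₁)` for the root-only class**: every edge at `a₃` joins a root (any multiplicities). -/
theorem jOneOne_of_rootsOnly (p : E → R) (hp : IsProbVec p)
    (hroot : ∀ e, a₃ ∈ ends e → ends e = s(a₁, a₃) ∨ ends e = s(a₂, a₃)) (h1 : a₁ ≠ a₃)
    (o : V) {b : V} (hb : b ≠ a₃) : JOneOne p ends o a₁ a₂ a₃ b :=
  jOneOne_of_i_of_ii p ends o a₁ a₂ a₃ b (zSplitI_of_rootsOnly p hp hroot h1 o hb)
    (zSplitII_of_rootsOnly p hp hroot h1 o b)

end Order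

end CaseOne

end Summit.Ventures.PercRepro2
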